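import Literature.NumberTheory.LFunctions.MoebiusAutomaticTransducerReduction
import Literature.NumberTheory.LFunctions.AutomaticSequenceTransducerPeriod
import HarnessLib

/-!
# Müllner's Proposition 3.2 in arithmetic-progression form: the bridge to the transducer estimate (proved)

Everything in this file is PROVED (plus one plain definition, a property with parameters that is
NOT asserted). It continues the formalisation of C. Müllner, *Automatic sequences fulfill the
Sarnak conjecture* (Duke Math. J. 166 (2017)) for the named fact
`Literature.NumberTheory.LFunctions.mullner_moebius_automatic` (Thm. 1.2, case `ξ = a`).

The tree has the reduction Prop. 3.3 (`mullner_moebius_automatic_of_transducerEstimate`,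
`MoebiusAutomaticTransducerReduction.lean`): Thm. 1.2 follows once every strongly connected base-`k`
automaton satisfies `TransducerMoebiusEstimateSync k δ' M π l1 l2` — a bound for `μ` summed over
the integers `n ≤ N` with prescribed leading `λ₁` digits `b`, prescribed residue `m mod k^{λ₂}`,
and prescribed transducer output `T(M, ·) = π` along the padded lower block of digits, uniformly
in `b, m`. Müllner proves Prop. 3.2 in §4.3 (arXiv:1602.03042, p. 22–23) by splitting off the
special representations `D_ℓ`, for which (Lemma 4.11) "the result follows from the well-known
result `∑_{n<N, n ≡ r mod s} μ(n) = o(N)`" once one notes that the leading-digit condition "is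
indeed a sum over at most two intervals", and by Vaaler approximation plus Thm. 4.4 (uniform in
the shift `r`) for the other representations. The present file isolates the elementary half of
that step which does not depend on representation theory, in the following form.

* `TransducerAPEstimate k δ' M₀` — the property: for every output `π`, modulus `q ≥ 1`, residue
  `c` and `ε > 0`, for all large `x`, UNIFORMLY IN THE SHIFT `r`,
  `|∑_{n < x, n ≡ c (q), T(M₀, (n + r)_k) = π} μ(n)| ≤ ε x`
  (digits of `n + r` read unpadded from the most significant one, as in Müllner's
  `T(n) := T(q₀, (n)_k)`, §3.1). This is exactly the shape delivered by §4.3: the `D_ℓ`-part by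
  `μ` in progressions, the rest by Thm. 4.4 (`sup_θ`, uniform in `r`) and additive characters
  mod `q`. It is NOT asserted here.
* `transducerMoebiusEstimate_of_apEstimate` — **the bridge**: if every state `M₀` of the
  transducer of `δ'` (letters `≥ k` acting trivially) has `TransducerAPEstimate`, then
  `TransducerMoebiusEstimate k δ' M π l1 l2` holds for all `M, π, l1, l2` (hence the `Sync`
  variant used by the reduction). Proof: choose a loop `W` at `M` in the transducer with leading
  digit `1` and `[W]_k ≥ k^{λ₁}` (strong connectivity of the transducer, `exists_image_eq`, and
  powers of a loop); for `n` in the block `⌊n / k^L⌋ = b` (`L = ν − λ₁`) the number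
  `ñ = [W]_k k^L + (n mod k^L) = n + r`, `r = ([W]_k − b) k^L ≥ 0`, has base-`k` expansion
  `W (n mod k^L)_k^L`, so by multiplicativity `T(M, W x) = T(M, W) ∘ T(M, x)` the condition
  `T(M, (n mod k^L)_k^L) = π` becomes `T(M, (n + r)_k) = π ∘ T(M, W)`; the block is an interval,
  written as the difference of two initial segments, each controlled by the hypothesis (uniformity
  in `r` absorbs the dependence of `r` on `N` and `b`; the finitely many residues `m < k^{λ₂}` are
  handled by a maximum of thresholds).
* `mullner_moebius_automatic_of_apEstimate` — hence Müllner's theorem follows from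
  `TransducerAPEstimate` for the transducers of strongly connected base-`k` automata.
* `transducerAPEstimate_of_minRank_eq_one` — non-vacuity: for transducers of rank `1` the
  property is `μ` in arithmetic progressions (`isLittleO_moebiusSum_residueClass`).

What remains open towards the fact is thus precisely `TransducerAPEstimate` for transducers of
rank `≥ 2`, i.e. Müllner's Thm. 4.4 (the Mauduit–Rivat type-I/II estimate) with the carry
property (Lemma 4.10) and the Fourier property (Thm. 4.5) of `n ↦ D(T(q₀, (n + r)_k))`.

## References
* C. Müllner, Duke Math. J. 166 (2017) 3219–3290 = arXiv:1602.03042: Prop. 3.2 (p. 15), §4.3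
  (Lemma 4.11 and "Proof of Prop. 3.2", pp. 22–23). [Mullner2017]
-/

noncomputable section

open Finset Filter Asymptotics
open scoped ArithmeticFunction.Moebius

namespace Literature.NumberTheory.LFunctions

section APEstimate

variable {σ' : Type*} [Fintype σ'] [DecidableEq σ']

/-- **Müllner's Prop. 3.2 in arithmetic-progression form** (a property of a base-`k` automaton
`δ'`, a state `M₀` of its naturally induced transducer; NOT asserted): for every output
permutation `π`, every modulus `q ≥ 1`, residue `c` and `ε > 0` there is `x₀` such that for all
`x ≥ x₀` and ALL shifts `r`,
`|∑_{n < x, n ≡ c (mod q), T(M₀, (n + r)_k) = π} μ(n)| ≤ ε x`,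
where `(n + r)_k` is the unpadded most-significant-digit-first expansion. Müllner obtains this in
§4.3: for the representations `D_ℓ` from `μ` in progressions (Lemma 4.11), otherwise from Thm. 4.4
(uniform in `θ` and `r`). [cite: Mullner2017, Prop. 3.2 / §4.3] -/
def TransducerAPEstimate (k : ℕ) (δ' : σ' → ℕ → σ') (M₀ : MinImage δ') : Prop :=
  ∀ (π : Equiv.Perm (Fin (minRank δ'))) (q : ℕ), 0 < q → ∀ (c : ℕ) (ε : ℝ), 0 < ε →
    ∃ x₀ : ℕ, ∀ x : ℕ, x₀ ≤ x → ∀ r : ℕ,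
      ‖∑ n ∈ (range x).filter (fun n => n % q = c ∧ M₀.T ((Nat.digits k (n + r)).reverse) = π),
        (μ n : ℂ)‖ ≤ ε * x

/-! ### A loop with leading digit `1` -/

/-- Every transducer state carries a loop over the digit alphabet whose first letter is `1`
(`k ≥ 2`, letters `≥ k` acting trivially): read `1`, then return by strong connectivity of the
transducer (`exists_image_eq`). [folklore] -/
theorem MinImage.exists_loop_head_one {k : ℕ} {δ' : σ' → ℕ → σ'}
    (htriv : ∀ q d, k ≤ d → δ' q d = q) (M : MinImage δ') :
    ∃ w : List ℕ, (∀ d ∈ w, d < k) ∧ M.next (1 :: w) = M := by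
  obtain ⟨u₀, hu₀⟩ := exists_image_eq (M.next [1]).2 M.2
  refine ⟨u₀.filter (· < k), fun d hd => mem_filter_lt hd, ?_⟩
  rw [show (1 :: u₀.filter (· < k)) = [1] ++ u₀.filter (· < k) from rfl, MinImage.next_append,
    MinImage.next_filter htriv]
  exact Subtype.ext hu₀

/-- The digits of `[W]_k · k^L + u` (`u < k^L`, `W` a digit word with non-zero leading letter),
most significant first, are `W` followed by the padded block of `u`. [folklore] -/
theorem reverse_digits_ofDigits_mul_pow_add {k : ℕ} (hk : 1 < k) {W : List ℕ} (hWd : ∀ d ∈ W, d < k)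
    (hWne : W ≠ []) (hWhead : W.head hWne ≠ 0) {L u : ℕ} (hu : u < k ^ L) :
    (Nat.digits k (u + k ^ L * Nat.ofDigits k W.reverse)).reverse = W ++ msbBlock k L u := by
  have hdig : Nat.digits k (Nat.ofDigits k W.reverse) = W.reverse := by
    refine Nat.digits_ofDigits k hk _ (fun d hd => hWd d (List.mem_reverse.1 hd)) fun h => ?_
    rw [List.getLast_reverse]
    exact hWhead
  have hω0 : 0 < Nat.ofDigits k W.reverse := by
    rw [pos_iff_ne_zero, ← Nat.digits_ne_nil_iff_ne_zero (b := k), hdig]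
    simpa using hWne
  rw [digits_add_pow_mul hk hu hω0, hdig, List.reverse_append, List.reverse_reverse, msbBlock]

/-- Lower bound for the value of a digit word with leading letter non-zero:
`k^{|W| - 1} ≤ [W]_k`. [folklore] -/
theorem pow_length_pred_le_ofDigits {k : ℕ} (hk : 1 < k) {W : List ℕ} (hWd : ∀ d ∈ W, d < k)
    (hWne : W ≠ []) (hWhead : W.head hWne ≠ 0) :
    k ^ (W.length - 1) ≤ Nat.ofDigits k W.reverse := by
  have hdig : Nat.digits k (Nat.ofDigits k W.reverse) = W.reverse := by
    refine Nat.digits_ofDigits k hk _ (fun d hd => hWd d (List.mem_reverse.1 hd)) fun h => ?_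
    rw [List.getLast_reverse]
    exact hWhead
  have hω0 : Nat.ofDigits k W.reverse ≠ 0 := by
    rw [← Nat.digits_ne_nil_iff_ne_zero (b := k), hdig]
    simpa using hWne
  have h := Nat.base_pow_length_digits_le k _ hk hω0
  rw [hdig, List.length_reverse] at h
  have hlen : 0 < W.length := List.length_pos_of_ne_nil hWne
  have hk0 : 0 < k := by omega
  have : k ^ W.length = k * k ^ (W.length - 1) := by
    rw [← pow_succ']; congr 1; omega
  rw [this] at h
  exact Nat.le_of_mul_le_mul_left h hk0

/-- **Re-rooting the padded block at a loop** (multiplicativity `T(M, W x) = T(M, W) ∘ T(M, x)`,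
Müllner §1.1, and `δ(M, W) = M`): for `u < k^L` and a loop `W` at `M` with non-zero leading letter,
`T(M, (u)_k^L) = π ↔ T(M, ([W]_k k^L + u)_k) = π · T(M, W)` (product in `Perm`, i.e.
`T(M, W)` followed by `π`). [cite: Mullner2017, §3.1] -/
theorem MinImage.T_msbBlock_eq_iff {k : ℕ} (hk : 1 < k) {δ' : σ' → ℕ → σ'} (M : MinImage δ')
    {W : List ℕ} (hWd : ∀ d ∈ W, d < k) (hWne : W ≠ []) (hWhead : W.head hWne ≠ 0)
    (hWloop : M.next W = M) {L u : ℕ} (hu : u < k ^ L) (π : Equiv.Perm (Fin (minRank δ'))) :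
    M.T (msbBlock k L u) = π ↔
      M.T ((Nat.digits k (u + k ^ L * Nat.ofDigits k W.reverse)).reverse) = π * M.T W := by
  rw [reverse_digits_ofDigits_mul_pow_add hk hWd hWne hWhead hu, MinImage.T_append, hWloop,
    ← Equiv.Perm.mul_def]
  exact (mul_left_inj (M.T W)).symm

/-- The trivial bound: a Möbius sum over a subset of `{0, …, y-1}` has norm `≤ y`. [folklore] -/
theorem norm_sum_filter_moebius_le (y : ℕ) (P : ℕ → Prop) [DecidablePred P] :
    ‖∑ n ∈ (range y).filter P, (μ n : ℂ)‖ ≤ y := by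
  calc ‖∑ n ∈ (range y).filter P, (μ n : ℂ)‖ ≤ ∑ n ∈ (range y).filter P, ‖(μ n : ℂ)‖ :=
        norm_sum_le _ _
    _ ≤ ∑ _n ∈ (range y).filter P, (1 : ℝ) := sum_le_sum fun n _ => norm_moebius_cast_le_one n
    _ = ((range y).filter P).card := by simp
    _ ≤ (range y).card := by exact_mod_cast card_filter_le _ _
    _ = y := by simp

/-! ### The bridge -/

/-- **`TransducerAPEstimate` (all states) implies `TransducerMoebiusEstimate` (all `M, π, λ₁, λ₂`)**
— the elementary half of Müllner's derivation of Prop. 3.2 (§4.3): re-rooting the padded lower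
block at a loop of `M` with leading digit `1`, and writing the leading-digit block as a
difference of two initial segments. See the module docstring. [cite: Mullner2017, Prop. 3.2 / §4.3] -/
theorem transducerMoebiusEstimate_of_apEstimate {k : ℕ} (hk : 2 ≤ k) {δ' : σ' → ℕ → σ'}
    (htriv : ∀ q d, k ≤ d → δ' q d = q) (H : ∀ M₀ : MinImage δ', TransducerAPEstimate k δ' M₀)
    (M : MinImage δ') (π : Equiv.Perm (Fin (minRank δ'))) (l1 l2 : ℕ) :
    TransducerMoebiusEstimate k δ' M π l1 l2 := by
  classical
  have hk1 : 1 < k := hk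
  have hk0 : 0 < k := by omega
  -- the loop `W` at `M`, leading digit `1`, length `≥ l1 + 1`
  obtain ⟨w, hwd, hwloop⟩ := M.exists_loop_head_one htriv
  have h1wd : ∀ d ∈ (1 :: w), d < k := by
    intro d hd
    rcases List.mem_cons.1 hd with rfl | h
    · exact hk1
    · exact hwd d h
  set W : List ℕ := (List.replicate (l1 + 1) (1 :: w)).flatten with hW_def
  have hWloop : M.next W = M := MinImage.next_flatten_replicate hwloop (l1 + 1)
  have hWd : ∀ d ∈ W, d < k := MinImage.digits_flatten_replicate h1wd _
  have hWcons : W = 1 :: (w ++ (List.replicate l1 (1 :: w)).flatten) := by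
    rw [hW_def, List.replicate_succ, List.flatten_cons, List.cons_append]
  have hWne : W ≠ [] := by rw [hWcons]; exact List.cons_ne_nil _ _
  have hWhead : W.head hWne ≠ 0 := by simp [hWcons]
  have hWlen : l1 + 1 ≤ W.length := by
    rw [hWcons, List.length_cons, List.length_append, List.length_flatten, List.map_replicate,
      List.sum_replicate, smul_eq_mul, List.length_cons]
    nlinarith [Nat.zero_le (w.length), Nat.zero_le l1]
  set ω : ℕ := Nat.ofDigits k W.reverse with hω_def
  have hωl1 : k ^ l1 ≤ ω :=
    (Nat.pow_le_pow_right hk0 (by omega)).trans (pow_length_pred_le_ofDigits hk1 hWd hWne hWhead)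
  -- unfold the property and fix `ε`
  intro ε hε
  set K2 := k ^ l2 with hK2
  have hK2pos : 0 < K2 := pow_pos hk0 _
  have hε4 : 0 < ε / 4 := by positivity
  choose x₀ hx₀ using fun c : ℕ => H M (π * M.T W) K2 hK2pos c (ε / 4) hε4
  set X₀ : ℕ := (range K2).sup x₀ with hX₀
  obtain ⟨N₁, hN₁⟩ := exists_nat_gt ((X₀ : ℝ) / (ε / 4))
  refine ⟨max X₀ N₁, fun N hN b m => ?_⟩
  have hNN₁ : N₁ ≤ N := (le_max_right _ _).trans hN
  have hX₀N : (X₀ : ℝ) ≤ ε / 4 * N := by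
    have : (X₀ : ℝ) / (ε / 4) ≤ N := hN₁.le.trans (by exact_mod_cast hNN₁)
    rwa [div_le_iff₀ hε4, mul_comm] at this
  have hN1 : (1 : ℝ) ≤ N := by
    have h0 : (0 : ℝ) ≤ (X₀ : ℝ) / (ε / 4) := by positivity
    have : (0 : ℝ) < N₁ := h0.trans_lt hN₁
    have hN₁1 : 1 ≤ N₁ := by exact_mod_cast this
    exact_mod_cast hN₁1.trans hNN₁
  -- notation for the given `N`
  set ν := (Nat.digits k N).length with hν
  set L := ν - l1 with hL
  set D := k ^ L with hD
  have hDpos : 0 < D := pow_pos hk0 _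
  -- residues `m ≥ K2` and blocks `b > ω` give empty sums
  rcases le_or_gt K2 m with hm | hm
  · have : ((range (N + 1)).filter fun n => n / D = b ∧ n % K2 = m ∧
        M.T (msbBlock k L (n % D)) = π) = ∅ := by
      refine filter_eq_empty_iff.2 fun n _ h => ?_
      exact absurd h.2.1 ((Nat.mod_lt n hK2pos).trans_le hm).ne
    rw [this, sum_empty, norm_zero]; positivity
  rcases lt_or_ge ω b with hb | hb
  · have hNν : N < k ^ ν := Nat.lt_base_pow_length_digits hk1
    have : ((range (N + 1)).filter fun n => n / D = b ∧ n % K2 = m ∧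
        M.T (msbBlock k L (n % D)) = π) = ∅ := by
      refine filter_eq_empty_iff.2 fun n hn h => ?_
      have hn' : n < k ^ ν := lt_of_le_of_lt (Nat.le_of_lt_succ (mem_range.1 hn)) hNν
      have h2 : k ^ l1 * D ≤ n := by
        calc k ^ l1 * D ≤ b * D := Nat.mul_le_mul_right _ (hωl1.trans hb.le)
          _ = n / D * D := by rw [h.1]
          _ ≤ n := Nat.div_mul_le_self n D
      have h3 : k ^ ν ≤ k ^ l1 * D := by
        rw [hD, ← pow_add]; exact Nat.pow_le_pow_right hk0 (by omega)
      omega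
    rw [this, sum_empty, norm_zero]; positivity
  -- the shift `R = (ω - b) D`
  set R : ℕ := (ω - b) * D with hR
  have hnR : ∀ n : ℕ, n / D = b → n + R = n % D + D * ω := by
    intro n h1
    have h := Nat.div_add_mod n D
    rw [h1] at h
    have hωb : b + (ω - b) = ω := Nat.add_sub_cancel' hb
    calc n + R = (D * b + n % D) + (ω - b) * D := by rw [h]
      _ = n % D + D * (b + (ω - b)) := by ring
      _ = n % D + D * ω := by rw [hωb]
  set Q : ℕ → Prop := fun n => n % K2 = m ∧
    M.T ((Nat.digits k (n + R)).reverse) = π * M.T W with hQ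
  -- (1) rewrite the transducer condition inside the block
  have hcongr : ((range (N + 1)).filter fun n => n / D = b ∧ n % K2 = m ∧
      M.T (msbBlock k L (n % D)) = π) = ((range (N + 1)).filter fun n => n / D = b).filter Q := by
    rw [filter_filter]
    refine filter_congr fun n _ => ?_
    have key : M.T (msbBlock k L (n % D)) = π ↔
        M.T ((Nat.digits k (n % D + D * ω)).reverse) = π * M.T W := by
      have h := M.T_msbBlock_eq_iff hk1 hWd hWne hWhead hWloop (L := L) (Nat.mod_lt n hDpos) π
      rw [← hω_def, ← hD] at h
      exact h
    constructor
    · rintro ⟨h1, h2, h3⟩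
      refine ⟨h1, h2, ?_⟩
      rw [hnR n h1]
      exact key.1 h3
    · rintro ⟨h1, h2, h3⟩
      refine ⟨h1, h2, key.2 ?_⟩
      rw [hnR n h1] at h3
      exact h3
  -- (2) each initial segment is small
  set g : ℕ → ℂ := fun n => if Q n then (μ n : ℂ) else 0 with hg
  have hseg : ∀ y : ℕ, y ≤ N + 1 → ‖∑ n ∈ range y, g n‖ ≤ ε / 2 * N := by
    intro y hy
    rw [hg, ← sum_filter]
    rcases le_or_gt (x₀ m) y with hxy | hxy
    · have h := hx₀ m y hxy R
      calc ‖∑ n ∈ (range y).filter Q, (μ n : ℂ)‖ ≤ ε / 4 * y := h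
        _ ≤ ε / 4 * (N + 1) := by gcongr; exact_mod_cast hy
        _ ≤ ε / 2 * N := by nlinarith
    · have hyX : y ≤ X₀ := hxy.le.trans (le_sup (f := x₀) (mem_range.2 hm))
      calc ‖∑ n ∈ (range y).filter Q, (μ n : ℂ)‖ ≤ y := norm_sum_filter_moebius_le y Q
        _ ≤ X₀ := by exact_mod_cast hyX
        _ ≤ ε / 4 * N := hX₀N
        _ ≤ ε / 2 * N := by nlinarith
  -- (3) the block is an interval: difference of two initial segments
  rw [hcongr, sum_filter, sum_filter_div_eq_eq_sum_Ico hDpos b N g]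
  rcases le_or_gt (b * D) (min ((b + 1) * D) (N + 1)) with hle | hgt
  · rw [sum_Ico_eq_sub _ hle]
    calc ‖∑ n ∈ range (min ((b + 1) * D) (N + 1)), g n - ∑ n ∈ range (b * D), g n‖
        ≤ ‖∑ n ∈ range (min ((b + 1) * D) (N + 1)), g n‖ + ‖∑ n ∈ range (b * D), g n‖ :=
          norm_sub_le _ _
      _ ≤ ε / 2 * N + ε / 2 * N :=
          add_le_add (hseg _ (min_le_right _ _)) (hseg _ (hle.trans (min_le_right _ _)))
      _ = ε * N := by ring
  · rw [Ico_eq_empty_of_le hgt.le, sum_empty, norm_zero]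
    positivity

/-- **Müllner 2017, Thm. 1.2 from Prop. 3.2 in arithmetic-progression form**: if for every
`k ≥ 2` and every strongly connected base-`k` automaton (letters `≥ k` acting trivially) every
state of its naturally induced transducer has `TransducerAPEstimate`, then
`mullner_moebius_automatic` holds — the tree's Prop. 3.3
(`mullner_moebius_automatic_of_transducerEstimate`) composed with the bridge
`transducerMoebiusEstimate_of_apEstimate`. [cite: Mullner2017, Prop. 3.3 and §4.3] -/
theorem mullner_moebius_automatic_of_apEstimate
    (H : ∀ (k : ℕ), 2 ≤ k → ∀ (σ' : Type) [Fintype σ'] [DecidableEq σ'] (δ' : σ' → ℕ → σ'),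
      IsStronglyConnected δ' → (∀ q d, k ≤ d → δ' q d = q) →
      ∀ M₀ : MinImage δ', TransducerAPEstimate k δ' M₀) :
    mullner_moebius_automatic :=
  mullner_moebius_automatic_of_transducerEstimate fun k hk σ' _ _ δ' hsc htriv M π l1 l2 =>
    (transducerMoebiusEstimate_of_apEstimate hk htriv (H k hk σ' δ' hsc htriv) M π l1 l2).sync

/-! ### Non-vacuity: transducers of rank one -/

/-- **The synchronizing case of the AP estimate**: if the transducer has rank `n₀ = 1` its group is
trivial, the output condition is void, and `TransducerAPEstimate` is `μ = o(x)` on residue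
classes (`isLittleO_moebiusSum_residueClass`, from the Siegel–Walfisz theorem), trivially uniform
in the shift. [cite: Mullner2017, Prop. 3.2 (case n₀(A) = 1)] -/
theorem transducerAPEstimate_of_minRank_eq_one {k : ℕ} {δ' : σ' → ℕ → σ'}
    (h1 : minRank δ' = 1) (M₀ : MinImage δ') : TransducerAPEstimate k δ' M₀ := by
  classical
  haveI : Subsingleton (Equiv.Perm (Fin (minRank δ'))) := by
    rw [h1]; infer_instance
  intro π q hq c ε hε
  have hb : ∀ n : ℕ, ‖(if n % q = c then (1 : ℂ) else 0)‖ ≤ 1 := by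
    intro n; split_ifs <;> simp
  obtain ⟨N₀, hN₀⟩ :=
    exists_forall_norm_sum_range_le (isLittleO_moebiusSum_residueClass hq c) hb hε
  refine ⟨N₀, fun x hx r => ?_⟩
  have hfilter : ((range x).filter fun n => n % q = c ∧
      M₀.T ((Nat.digits k (n + r)).reverse) = π) = (range x).filter fun n => n % q = c := by
    refine filter_congr fun n _ => ?_
    simp only [Subsingleton.elim (M₀.T _) π, and_true]
  rw [hfilter, sum_filter]
  have := hN₀ x hx x (Nat.le_succ x)
  refine le_trans (le_of_eq ?_) this
  congr 1
  refine sum_congr rfl fun n _ => ?_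
  split_ifs <;> simp

end APEstimate

end Literature.NumberTheory.LFunctions
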